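import Mathlib.Probability.Distributions.Gaussian.Real
import Mathlib.Analysis.SpecialFunctions.Gamma.Basic
import Mathlib.MeasureTheory.Integral.Prod
import Mathlib.Analysis.SpecificLimits.Basic
import HarnessLib

/-!
# The Riesz weight `|s|^{-δ}` as a Gaussian mixture; Gaussian averaging of translation-positive sums

Two elementary tools for passing positivity statements about FINITE configurations on the line
to INTEGRATED statements against the Riesz weight `|s|^{-δ}` (`0 < δ`), without Riemann sums:

* `integral_mul_exp_neg_nonneg_of_sum_sub_nonneg` — **Gaussian averaging.** If `Φ : ℝ → ℝ`
  is bounded continuous and `0 ≤ ∑_{j,l} Φ(σ_j - σ_l)` for every finite family of reals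
  `σ_1, …, σ_N` (e.g. `Φ` of positive type, tested with the constant vector), then
  `0 ≤ ∫ Φ(s) e^{-s²u} ds` for every `u > 0`.  Proof: average the hypothesis over
  `σ ∼ N(0,v)^{⊗N}`; the diagonal contributes `N Φ(0)`, each of the `N(N-1)` off-diagonal pairs
  contributes `∫ Φ dN(0,2v)` (the coordinates of a product measure are independent — Mathlib's
  `iIndepFun_pi` — and `N(0,v) ∗ N(0,v) = N(0,2v)`, `gaussianReal_conv_gaussianReal`), so
  `0 ≤ N Φ(0) + N(N-1) ∫ Φ dN(0,2v)` (`pi_gaussianReal_expectation_nonneg`); divide by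
  `N(N-1)` and let `N → ∞`.
* `abs_rpow_neg_eq_inv_Gamma_mul_integral` — Euler's integral in the form
  `|s|^{-δ} = Γ(δ/2)^{-1} ∫_0^∞ u^{δ/2-1} e^{-s²u} du` (`s ≠ 0`; Mathlib's
  `Real.integral_rpow_mul_exp_neg_mul_Ioi`), and the resulting Fubini identity
  `integral_mul_abs_rpow_neg_eq_integral_gaussian`:
  `∫ k(s)|s|^{-δ} ds = Γ(δ/2)^{-1} ∫_0^∞ u^{δ/2-1} (∫ k(s) e^{-s²u} ds) du` for `k ≥ 0` continuous
  with `k |·|^{-δ}` integrable (the double integrand is nonnegative with finite iterated integral).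

Together: an inequality `0 ≤ ∫ Φ(s)|s|^{-δ} ds` follows from its Gaussian-weighted instances,
which in turn follow from finite-configuration positivity.  Used by the reflection-positivity
transfer to probed X-rays (route `CriticalPhenomena/Ising3DConformalLimit/HyperoctahedralRP`,
item `HRP2Rigidity`, stub `stub_probedXRayRP`).

References: the Gamma-function representation of negative powers is Euler's; Gaussian
(completely monotone) mixtures and functions of positive type: C. Berg, J. P. R. Christensen,
P. Ressel, *Harmonic Analysis on Semigroups*, GTM 100 (1984), Ch. 3.  Everything here is
standard and tagged `[folklore]`.  Mathlib has the ingredients (`gaussianReal`, `iIndepFun_pi`,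
`Real.integral_rpow_mul_exp_neg_mul_Ioi`, `integral_integral_swap`) but neither statement
(`lean search` 2026-08-16: `Gaussian mixture`, `sum_sub_nonneg`, `rpow_neg_eq_integral`).
NOT here: positive-definite functions / Bochner's theorem, general mixing measures.
-/

open MeasureTheory ProbabilityTheory Set Filter
open scoped BigOperators NNReal Topology

namespace Literature.Analysis.SpecialFunctions

noncomputable section

/-! ### Gaussian averaging of translation-positive sums -/

/-- The difference of two distinct coordinates of `N(0,v)^{⊗N}` has law `N(0, 2v)`
(independence of the coordinates of a product measure and `N(0,v) ∗ N(0,v) = N(0,2v)`).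
[folklore] -/
theorem hasLaw_sub_pi_gaussianReal (v : ℝ≥0) {N : ℕ} {j l : Fin N} (hjl : j ≠ l) :
    HasLaw (fun σ : Fin N → ℝ => σ j - σ l) (gaussianReal 0 (v + v))
      (Measure.pi fun _ : Fin N => gaussianReal 0 v) := by
  have hind : iIndepFun (fun (i : Fin N) (σ : Fin N → ℝ) => σ i)
      (Measure.pi fun _ : Fin N => gaussianReal 0 v) :=
    iIndepFun_pi (X := fun _ x => x) fun _ => aemeasurable_id
  have hX : HasLaw (fun σ : Fin N → ℝ => σ j) (gaussianReal 0 v)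
      (Measure.pi fun _ : Fin N => gaussianReal 0 v) :=
    (measurePreserving_eval (fun _ : Fin N => gaussianReal 0 v) j).hasLaw
  have hY : HasLaw (fun σ : Fin N → ℝ => -σ l) (gaussianReal 0 v)
      (Measure.pi fun _ : Fin N => gaussianReal 0 v) := by
    refine ⟨(measurable_pi_apply l).neg.aemeasurable, ?_⟩
    rw [show (fun σ : Fin N → ℝ => -σ l) = Neg.neg ∘ Function.eval l from rfl,
      ← Measure.map_map measurable_neg
        (measurePreserving_eval (fun _ : Fin N => gaussianReal 0 v) l).measurable,
      (measurePreserving_eval (fun _ : Fin N => gaussianReal 0 v) l).map_eq,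
      gaussianReal_map_neg, neg_zero]
  have hXY := (hind.indepFun hjl).comp measurable_id measurable_neg
  have h := hXY.hasLaw_fun_add hX hY
  rw [gaussianReal_conv_gaussianReal, add_zero] at h
  simpa [sub_eq_add_neg] using h

/-- Expectation of the grid functional under `N(0,v)^{⊗N}`: if `0 ≤ ∑_{j,l} Φ(σ_j - σ_l)` for
all `σ : Fin N → ℝ` (`Φ` bounded continuous), then `0 ≤ N Φ(0) + N(N-1) ∫ Φ dN(0,2v)` — the
diagonal terms contribute `Φ(0)` each, the off-diagonal ones `∫ Φ dN(0,2v)` each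
(`hasLaw_sub_pi_gaussianReal`). [folklore] -/
theorem pi_gaussianReal_expectation_nonneg (Φ : ℝ → ℝ) (hΦc : Continuous Φ) (B : ℝ)
    (hB : ∀ s, |Φ s| ≤ B) (v : ℝ≥0) (N : ℕ)
    (hpos : ∀ σ : Fin N → ℝ, 0 ≤ ∑ j, ∑ l, Φ (σ j - σ l)) :
    0 ≤ (N : ℝ) * Φ 0 + (N : ℝ) * ((N : ℝ) - 1) * ∫ s, Φ s ∂(gaussianReal 0 (v + v)) := by
  have hpair : ∀ j l : Fin N,
      ∫ σ, Φ (σ j - σ l) ∂(Measure.pi fun _ : Fin N => gaussianReal 0 v) =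
        if j = l then Φ 0 else ∫ s, Φ s ∂(gaussianReal 0 (v + v)) := by
    intro j l
    split_ifs with hjl
    · subst hjl
      simp
    · have := (hasLaw_sub_pi_gaussianReal v hjl).integral_comp (f := Φ)
        hΦc.aestronglyMeasurable
      simpa [Function.comp_def] using this
  have hint : ∀ j l : Fin N, Integrable (fun σ : Fin N → ℝ => Φ (σ j - σ l))
      (Measure.pi fun _ : Fin N => gaussianReal 0 v) := fun j l =>
    Integrable.of_bound
      (hΦc.comp ((continuous_apply j).sub (continuous_apply l))).aestronglyMeasurable B
      (Eventually.of_forall fun σ => hB (σ j - σ l))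
  have h0 : 0 ≤ ∫ σ, ∑ j, ∑ l, Φ (σ j - σ l) ∂(Measure.pi fun _ : Fin N => gaussianReal 0 v) :=
    integral_nonneg fun σ => hpos σ
  have hexp : ∫ σ, ∑ j, ∑ l, Φ (σ j - σ l) ∂(Measure.pi fun _ : Fin N => gaussianReal 0 v) =
      ∑ j, ∑ l, ∫ σ, Φ (σ j - σ l) ∂(Measure.pi fun _ : Fin N => gaussianReal 0 v) := by
    rw [integral_finsetSum _ fun j _ => integrable_finsetSum _ fun l _ => hint j l]
    exact Finset.sum_congr rfl fun j _ => integral_finsetSum _ fun l _ => hint j l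
  rw [hexp] at h0
  simp_rw [hpair] at h0
  -- `∑_{j,l} [j = l] A + [j ≠ l] I = N A + N (N - 1) I`
  have hsum : ∀ A I : ℝ, ∑ j : Fin N, ∑ l : Fin N, (if j = l then A else I) =
      (N : ℝ) * A + (N : ℝ) * ((N : ℝ) - 1) * I := by
    intro A I
    have h1 : ∀ j : Fin N, ∑ l : Fin N, (if j = l then A else I) = A + ((N : ℝ) - 1) * I := by
      intro j
      have h2 : ∀ l : Fin N, (if j = l then A else I) = I + if j = l then A - I else 0 := by
        intro l
        split_ifs <;> ring
      rw [Finset.sum_congr rfl fun l _ => h2 l, Finset.sum_add_distrib, Finset.sum_ite_eq]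
      simp only [Finset.mem_univ, if_true, Finset.sum_const, Finset.card_univ,
        Fintype.card_fin, nsmul_eq_mul]
      ring
    rw [Finset.sum_congr rfl fun j _ => h1 j]
    simp only [Finset.sum_const, Finset.card_univ, Fintype.card_fin, nsmul_eq_mul]
    ring
  rwa [hsum] at h0

/-- **Gaussian-weighted positivity from translation positivity on finite families.**  If
`Φ : ℝ → ℝ` is bounded continuous and `0 ≤ ∑_{j,l} Φ(σ_j - σ_l)` for every finite family of
reals `σ`, then `0 ≤ ∫ Φ(s) e^{-s² u} ds` for every `u > 0`: by
`pi_gaussianReal_expectation_nonneg` with `v = 1/(4u)`, `0 ≤ Φ(0)/(N-1) + ∫ Φ dN(0,2v)` for all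
`N ≥ 2`; let `N → ∞` and write out the density of `N(0, 1/(2u))`. [folklore] -/
theorem integral_mul_exp_neg_nonneg_of_sum_sub_nonneg (Φ : ℝ → ℝ) (hΦc : Continuous Φ)
    (hΦb : ∃ B, ∀ s, |Φ s| ≤ B)
    (hpos : ∀ (N : ℕ) (σ : Fin N → ℝ), 0 ≤ ∑ j, ∑ l, Φ (σ j - σ l))
    {u : ℝ} (hu : 0 < u) :
    0 ≤ ∫ s, Φ s * Real.exp (-(s ^ 2 * u)) := by
  obtain ⟨B, hB⟩ := hΦb
  set v : ℝ≥0 := Real.toNNReal (1 / (4 * u)) with hv_def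
  have hvpos : (0 : ℝ≥0) < v := Real.toNNReal_pos.mpr (by positivity)
  have hvcoe : (v : ℝ) = 1 / (4 * u) := Real.coe_toNNReal _ (by positivity)
  have hvv : v + v ≠ 0 := (add_pos hvpos hvpos).ne'
  -- Step A: the Gaussian-law average is nonnegative
  have hI : 0 ≤ ∫ s, Φ s ∂(gaussianReal 0 (v + v)) := by
    have hN : ∀ k : ℕ, 0 ≤ Φ 0 * (1 / ((k : ℝ) + 1)) + ∫ s, Φ s ∂(gaussianReal 0 (v + v)) := by
      intro k
      have h := pi_gaussianReal_expectation_nonneg Φ hΦc B hB v (k + 2) (hpos (k + 2))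
      push_cast at h
      have hkpos : (0 : ℝ) < ((k : ℝ) + 2) * ((k : ℝ) + 1) := by positivity
      rw [show Φ 0 * (1 / ((k : ℝ) + 1)) + ∫ s, Φ s ∂(gaussianReal 0 (v + v)) =
          (((k : ℝ) + 2) * Φ 0 + ((k : ℝ) + 2) * ((k : ℝ) + 2 - 1) *
            ∫ s, Φ s ∂(gaussianReal 0 (v + v))) / (((k : ℝ) + 2) * ((k : ℝ) + 1)) by
        field_simp
        ring]
      exact div_nonneg h hkpos.le
    have hlim : Tendsto
        (fun k : ℕ => Φ 0 * (1 / ((k : ℝ) + 1)) + ∫ s, Φ s ∂(gaussianReal 0 (v + v)))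
        atTop (𝓝 (Φ 0 * 0 + ∫ s, Φ s ∂(gaussianReal 0 (v + v)))) :=
      ((tendsto_one_div_add_atTop_nhds_zero_nat (𝕜 := ℝ)).const_mul (Φ 0)).add
        tendsto_const_nhds
    have := ge_of_tendsto' hlim hN
    simpa using this
  -- Step B: write out the density of `N(0, v + v) = N(0, 1/(2u))`
  have hdens : ∀ s, gaussianPDFReal 0 (v + v) s =
      (√(2 * Real.pi * ↑(v + v)))⁻¹ * Real.exp (-(s ^ 2 * u)) := by
    intro s
    rw [gaussianPDFReal]
    congr 2
    rw [NNReal.coe_add, hvcoe]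
    field_simp
    ring
  rw [integral_gaussianReal_eq_integral_smul hvv] at hI
  have hfun : (fun s => gaussianPDFReal 0 (v + v) s • Φ s) =
      fun s => (√(2 * Real.pi * ↑(v + v)))⁻¹ * (Φ s * Real.exp (-(s ^ 2 * u))) := by
    funext s
    rw [hdens s, smul_eq_mul]
    ring
  rw [hfun, integral_const_mul] at hI
  have hC : 0 < (√(2 * Real.pi * ↑(v + v)))⁻¹ := by
    have : (0 : ℝ) < ↑(v + v) := by exact_mod_cast add_pos hvpos hvpos
    positivity
  exact (mul_nonneg_iff_of_pos_left hC).1 hI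

/-! ### The Riesz weight as a Gaussian mixture; Fubini -/

/-- Euler's integral in the form `|s|^{-δ} = Γ(δ/2)^{-1} ∫_0^∞ u^{δ/2-1} e^{-s² u} du`
(`s ≠ 0`, `δ > 0`). [folklore] -/
theorem abs_rpow_neg_eq_inv_Gamma_mul_integral {δ : ℝ} (hδ : 0 < δ) {s : ℝ} (hs : s ≠ 0) :
    |s| ^ (-δ) = (Real.Gamma (δ / 2))⁻¹ *
      ∫ u in Ioi (0 : ℝ), u ^ (δ / 2 - 1) * Real.exp (-(s ^ 2 * u)) := by
  have hs2 : 0 < s ^ 2 := by positivity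
  have hΓ : Real.Gamma (δ / 2) ≠ 0 := (Real.Gamma_pos_of_pos (by positivity)).ne'
  rw [Real.integral_rpow_mul_exp_neg_mul_Ioi (by positivity : 0 < δ / 2) hs2,
    mul_comm ((1 / s ^ 2) ^ (δ / 2)) _, ← mul_assoc, inv_mul_cancel₀ hΓ, one_mul, one_div,
    Real.inv_rpow hs2.le, Real.rpow_neg (abs_nonneg s), ← sq_abs]
  congr 1
  rw [← Real.rpow_natCast, ← Real.rpow_mul (abs_nonneg s)]
  congr 1
  push_cast
  ring

/-- **Fubini against the Gaussian mixture.**  For `k` continuous and nonnegative with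
`k(s)|s|^{-δ}` integrable (`δ > 0`), the function `(s, u) ↦ k(s) u^{δ/2-1} e^{-s²u}` is integrable
on `ℝ × (0, ∞)` and `∫ k(s)|s|^{-δ} ds = Γ(δ/2)^{-1} ∫_0^∞ u^{δ/2-1} (∫ k(s) e^{-s²u} ds) du`.
[folklore] -/
theorem integral_mul_abs_rpow_neg_eq_integral_gaussian {δ : ℝ} (hδ : 0 < δ) {k : ℝ → ℝ}
    (hk : Continuous k) (hk0 : ∀ s, 0 ≤ k s) (hint : Integrable (fun s => k s * |s| ^ (-δ))) :
    Integrable (fun q : ℝ × ℝ => k q.1 * (q.2 ^ (δ / 2 - 1) * Real.exp (-(q.1 ^ 2 * q.2))))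
        ((volume : Measure ℝ).prod (volume.restrict (Ioi 0))) ∧
    ∫ s, k s * |s| ^ (-δ) = (Real.Gamma (δ / 2))⁻¹ *
      ∫ u in Ioi (0 : ℝ), u ^ (δ / 2 - 1) * ∫ s, k s * Real.exp (-(s ^ 2 * u)) := by
  set F : ℝ × ℝ → ℝ := fun q => k q.1 * (q.2 ^ (δ / 2 - 1) * Real.exp (-(q.1 ^ 2 * q.2)))
    with hF
  have hFm : Measurable F := by
    simp only [hF]
    fun_prop
  have hΓ : 0 < Real.Gamma (δ / 2) := Real.Gamma_pos_of_pos (by positivity)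
  -- the Gamma integrand: integrable, with integral `Γ(δ/2) |s|^{-δ}`
  have hGam : ∀ s : ℝ, s ≠ 0 →
      IntegrableOn (fun u : ℝ => u ^ (δ / 2 - 1) * Real.exp (-(s ^ 2 * u))) (Ioi 0) ∧
      ∫ u in Ioi (0 : ℝ), u ^ (δ / 2 - 1) * Real.exp (-(s ^ 2 * u)) =
        Real.Gamma (δ / 2) * |s| ^ (-δ) := by
    intro s hs
    have heq : ∫ u in Ioi (0 : ℝ), u ^ (δ / 2 - 1) * Real.exp (-(s ^ 2 * u)) =
        Real.Gamma (δ / 2) * |s| ^ (-δ) := by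
      rw [abs_rpow_neg_eq_inv_Gamma_mul_integral hδ hs, ← mul_assoc, mul_inv_cancel₀ hΓ.ne',
        one_mul]
    refine ⟨?_, heq⟩
    by_contra hni
    rw [integral_undef hni] at heq
    have : 0 < Real.Gamma (δ / 2) * |s| ^ (-δ) :=
      mul_pos hΓ (Real.rpow_pos_of_pos (abs_pos.2 hs) _)
    linarith
  have hae : ∀ᵐ s : ℝ, s ≠ 0 := by
    have : ({(0 : ℝ)}ᶜ : Set ℝ) ∈ ae (volume : Measure ℝ) :=
      compl_mem_ae_iff.mpr (measure_singleton 0)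
    filter_upwards [this] with s hs
    exact hs
  have hF0 : ∀ s : ℝ, ∀ u ∈ Ioi (0 : ℝ), 0 ≤ F (s, u) := fun s u hu =>
    mul_nonneg (hk0 s) (mul_nonneg (Real.rpow_nonneg (le_of_lt hu) _) (Real.exp_pos _).le)
  have hprod : Integrable F ((volume : Measure ℝ).prod (volume.restrict (Ioi 0))) := by
    rw [integrable_prod_iff hFm.aestronglyMeasurable]
    constructor
    · filter_upwards [hae] with s hs
      exact (hGam s hs).1.const_mul (k s)
    · have heq : (fun s => ∫ u in Ioi (0 : ℝ), ‖F (s, u)‖) =ᵐ[volume]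
          fun s => Real.Gamma (δ / 2) * (k s * |s| ^ (-δ)) := by
        filter_upwards [hae] with s hs
        have hnn : EqOn (fun u => ‖F (s, u)‖)
            (fun u => k s * (u ^ (δ / 2 - 1) * Real.exp (-(s ^ 2 * u)))) (Ioi 0) :=
          fun u hu => Real.norm_of_nonneg (hF0 s u hu)
        rw [setIntegral_congr_fun measurableSet_Ioi hnn, integral_const_mul, (hGam s hs).2]
        ring
      rw [integrable_congr heq]
      exact hint.const_mul _
  refine ⟨hprod, ?_⟩
  calc ∫ s, k s * |s| ^ (-δ)
      = ∫ s, (Real.Gamma (δ / 2))⁻¹ * ∫ u in Ioi (0 : ℝ), F (s, u) := by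
        refine integral_congr_ae ?_
        filter_upwards [hae] with s hs
        simp only [hF]
        rw [integral_const_mul, (hGam s hs).2]
        field_simp
    _ = (Real.Gamma (δ / 2))⁻¹ * ∫ s, ∫ u in Ioi (0 : ℝ), F (s, u) := integral_const_mul _ _
    _ = (Real.Gamma (δ / 2))⁻¹ * ∫ u in Ioi (0 : ℝ), ∫ s, F (s, u) := by
        rw [integral_integral_swap (f := fun s u => F (s, u)) hprod]
    _ = (Real.Gamma (δ / 2))⁻¹ *
          ∫ u in Ioi (0 : ℝ), u ^ (δ / 2 - 1) * ∫ s, k s * Real.exp (-(s ^ 2 * u)) := by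
        congr 1
        refine setIntegral_congr_fun measurableSet_Ioi fun u _ => ?_
        simp only [hF]
        rw [← integral_const_mul]
        congr 1
        funext s
        ring

end

end Literature.Analysis.SpecialFunctions
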